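import Literature.Geometry.Symplectic.NearSymplecticAdaptedFrame
import HarnessLib

/-!
# The gradient along a zero circle: kernel, adapted frame and the `S`-matrix

Topic `Literature/Geometry/Symplectic` (groundwork `--supports`
`Literature.Geometry.Symplectic.relNearSymplecticTaubesTubes_exists`; everything here is PROVED,
no named fact is introduced).

Step H-a4 of the normal form along an even zero circle of a strictly near-symplectic form
(Honda 2004, §4 Thm. 5; Perutz 2006, Lemma 3.1): the first-order data of the form along a zero
circle `γ`, in the vocabulary of `NearSymplecticForms.lean` (`zeroGradient`),
`NearSymplecticZeroCircles.lean` (`zeroCircleTangent`, `zeroNormalForm`) and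
`NearSymplecticAdaptedFrame.lean`:

* `IsZeroCircle.zeroGradient_tangent_eq_zero` — **the tangent of a zero circle lies in the
  kernel of the gradient**, `(∇α)(γ θ)(γ'(θ)) = 0` (Perutz 2006, proof of Lemma 1.2:
  `T_x Z_ω = ker (∇ω)(x)`; here: `α ∘ γ ≡ 0`, chain rule in the chart at `γ θ`);
* `IsZeroCircle.exists_smul_tangent` — at a transverse zero the kernel IS the tangent line:
  `(∇α)(γ θ) u = 0 → u ∈ ℝ γ'(θ)` (rank–nullity);
* `hondaBeta₁_stdVec_zero`, … — `β₁(e₀, w) = w₁`, `β₂(e₀, w) = w₂`, `β₃(e₀, w) = w₃`;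
* `zeroNormalForm_frame` — **Perutz's form `S` in an adapted frame**: if `A e₀ = τ`,
  `η_i(Au, Av) = c β_i(u, v)` and `∇_W α = Σ_k S_k(W) η_k`, then
  `S_z(Av, Aw) = (∇_{Av} α)(τ, Aw) = c Σ_k S_k(Av) w_{k+1}` (Perutz 2006, §2 eq. (2) and §3,
  "`ω(t, x) = x · S(t) β + O(|x|²)`": the `4 × 3` matrix of the gradient in the frame, restricted
  to the normal directions, is the matrix of `S_z`), and `frameMatrix_symm` — for a closed form
  this `3 × 3` matrix is symmetric (`IsClosedForm.zeroNormalForm_symm`).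

## References

* T. Perutz, *Zero-sets of near-symplectic forms*, J. Symplectic Geom. 4 (2006), Lemma 1.2,
  §2 eq. (2), §2.3, §3 [Perutz2006].
* K. Honda, *Local properties of self-dual harmonic 2-forms on a 4-manifold*, J. reine angew.
  Math. 577 (2004), §4 Thm. 5 [Honda2004LocalSD].
-/

noncomputable section

open Set Function Filter Module Literature.Geometry.Kaehler Literature.Topology.FourManifolds
open scoped Manifold ContDiff Topology

namespace Literature.Geometry.Symplectic

/-- Local notation for the model space `ℝ⁴ = EuclideanSpace ℝ (Fin 4)`. -/
local notation "E4" => EuclideanSpace ℝ (Fin 4)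

section Kernel

variable {M : Type*} [TopologicalSpace M] [ChartedSpace E4 M]

/-- From the source `ℝ`, `mfderiv` of a curve `γ` at `θ` is the Fréchet derivative at `θ` of
`γ` written in the chart at `γ θ`. [folklore] -/
theorem mfderiv_curve_eq_fderiv {γ : ℝ → M} {θ : ℝ}
    (hγ : MDifferentiableAt 𝓘(ℝ, ℝ) (𝓡 4) γ θ) :
    mfderiv 𝓘(ℝ, ℝ) (𝓡 4) γ θ = fderiv ℝ (writtenInExtChartAt 𝓘(ℝ, ℝ) (𝓡 4) θ γ) θ := by
  rw [hγ.mfderiv]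
  simp only [modelWithCornersSelf_coe, range_id, fderivWithin_univ, extChartAt_model_space_eq_id,
    PartialEquiv.refl_coe, id_eq]

/-- A curve written in the charts (source `ℝ`) is the chart at `γ θ` composed with the curve.
[folklore] -/
theorem writtenInExtChartAt_curve (γ : ℝ → M) (θ : ℝ) :
    writtenInExtChartAt 𝓘(ℝ, ℝ) (𝓡 4) θ γ = extChartAt (𝓡 4) (γ θ) ∘ γ := by
  ext t
  simp only [writtenInExtChartAt, comp_apply, extChartAt_model_space_eq_id,
    PartialEquiv.refl_symm, PartialEquiv.refl_coe, id_eq]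

/-- The chart representative of a form vanishes at the chart image of a zero. [folklore] -/
theorem inChart_eq_zero_of_apply_eq_zero (α : MForm (𝓡 4) M ℝ 2) (x₀ : M) {y : E4}
    (h : α ((extChartAt (𝓡 4) x₀).symm y) = 0) : α.inChart x₀ y = 0 := by
  ext v
  rw [MForm.inChart_apply, h]
  rfl

variable {α : MForm (𝓡 4) M ℝ 2} {γ : ℝ → M}

/-- Along a zero circle, the chart representative of `α` at `γ θ` vanishes on the chart image of
`γ` near `θ`. [folklore] -/
theorem IsZeroCircle.inChart_comp_eventuallyEq_zero (h : IsZeroCircle α γ) (θ : ℝ) :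
    (fun t => α.inChart (γ θ) (extChartAt (𝓡 4) (γ θ) (γ t))) =ᶠ[𝓝 θ] fun _ => 0 := by
  have hcont : ContinuousAt γ θ := (h.contMDiff θ).continuousAt
  have hsrc : ∀ᶠ t in 𝓝 θ, γ t ∈ (extChartAt (𝓡 4) (γ θ)).source :=
    hcont.preimage_mem_nhds (extChartAt_source_mem_nhds (I := 𝓡 4) (γ θ))
  filter_upwards [hsrc] with t ht
  refine inChart_eq_zero_of_apply_eq_zero α (γ θ) ?_
  rw [(extChartAt (𝓡 4) (γ θ)).left_inv ht]
  exact h.apply_eq_zero t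

/-- **The tangent of a zero circle lies in the kernel of the gradient**:
`(∇α)(γ θ)(γ'(θ)) = 0` for a form smooth at `γ θ` (Perutz 2006, proof of Lemma 1.2:
`T Z_ω ⊆ ker ∇ω`; differentiate `α ∘ γ ≡ 0` in the chart at `γ θ`).
[cite: Perutz2006, Lemma 1.2] -/
theorem IsZeroCircle.zeroGradient_tangent_eq_zero (h : IsZeroCircle α γ) {θ : ℝ}
    (hα : α.SmoothAt (γ θ)) : zeroGradient α (γ θ) (zeroCircleTangent γ θ) = 0 := by
  set x := γ θ with hx
  set f : E4 → E4 [⋀^Fin 2]→L[ℝ] ℝ := α.inChart x with hf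
  set c : ℝ → E4 := extChartAt (𝓡 4) x ∘ γ with hc
  have hγθ : ContMDiffAt 𝓘(ℝ, ℝ) (𝓡 4) ∞ γ θ := h.contMDiff θ
  have hγd : MDifferentiableAt 𝓘(ℝ, ℝ) (𝓡 4) γ θ := hγθ.mdifferentiableAt (by simp)
  -- differentiability of the written curve and of the chart representative
  have hcd : DifferentiableAt ℝ c θ := by
    have h2 := (contMDiffAt_iff.1 hγθ).2
    simp only [modelWithCornersSelf_coe, range_id, extChartAt_model_space_eq_id,
      PartialEquiv.refl_coe, CompTriple.comp_eq, PartialEquiv.refl_symm, id_eq] at h2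
    exact (h2.contDiffAt univ_mem).differentiableAt (by simp)
  have hfd : DifferentiableAt ℝ f (c θ) := by
    have hs' : ContDiffWithinAt ℝ ∞ (α.inChart x) (range (𝓡 4)) (extChartAt (𝓡 4) x x) := hα
    simp only [modelWithCornersSelf_coe, range_id] at hs'
    exact (hs'.contDiffAt univ_mem).differentiableAt (by simp)
  -- the composite vanishes near `θ`, so its derivative vanishes
  have hfc : f ∘ c = fun t => α.inChart (γ θ) (extChartAt (𝓡 4) (γ θ) (γ t)) := rfl
  have hzero : fderiv ℝ (f ∘ c) θ = 0 := by
    rw [hfc, (h.inChart_comp_eventuallyEq_zero θ).fderiv_eq]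
    exact fderiv_const_apply 0
  have hchain : fderiv ℝ (f ∘ c) θ = (fderiv ℝ f (c θ)).comp (fderiv ℝ c θ) :=
    fderiv_comp θ hfd hcd
  have h1 : fderiv ℝ f (c θ) (fderiv ℝ c θ 1) = 0 := by
    have := DFunLike.congr_fun (hchain.symm.trans hzero) 1
    simpa using this
  -- identify with the gradient applied to the tangent
  unfold zeroGradient zeroCircleTangent
  rw [mfderiv_curve_eq_fderiv hγd, writtenInExtChartAt_curve]
  exact h1

/-- **At a transverse zero the kernel of the gradient is the tangent line of the zero circle**:
every kernel vector is a multiple of `γ'(θ)` (rank–nullity: the kernel is a line, and it contains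
`γ'(θ) ≠ 0`). [cite: Perutz2006, Lemma 1.2] -/
theorem IsZeroCircle.exists_smul_tangent (h : IsZeroCircle α γ) {θ : ℝ} (hα : α.SmoothAt (γ θ))
    (hT : IsTransverseZero α (γ θ)) {u : E4} (hu : zeroGradient α (γ θ) u = 0) :
    ∃ c : ℝ, c • zeroCircleTangent γ θ = u := by
  have hτk : (⟨zeroCircleTangent γ θ, LinearMap.mem_ker.2 (h.zeroGradient_tangent_eq_zero hα)⟩ :
      LinearMap.ker (zeroGradient α (γ θ)).toLinearMap) ≠ 0 :=
    fun h0 => h.zeroCircleTangent_ne_zero θ (congrArg Subtype.val h0)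
  obtain ⟨c, hc⟩ :=
    (finrank_eq_one_iff_of_nonzero' _ hτk).1 hT.finrank_ker_eq ⟨u, LinearMap.mem_ker.2 hu⟩
  exact ⟨c, congrArg Subtype.val hc⟩

end Kernel

/-! ### Perutz's form `S` in an adapted frame -/

section Frame

/-- `β₁(e₀, w) = w₁`. [folklore] -/
@[simp] theorem hondaBeta₁_stdVec_zero (w : E4) : hondaBeta₁ ![stdVec 0, w] = w 1 := by
  simp [hondaBeta₁_apply]

/-- `β₂(e₀, w) = w₂`. [folklore] -/
@[simp] theorem hondaBeta₂_stdVec_zero (w : E4) : hondaBeta₂ ![stdVec 0, w] = w 2 := by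
  simp [hondaBeta₂_apply]

/-- `β₃(e₀, w) = w₃`. [folklore] -/
@[simp] theorem hondaBeta₃_stdVec_zero (w : E4) : hondaBeta₃ ![stdVec 0, w] = w 3 := by
  simp [hondaBeta₃_apply]

variable {M : Type*} [TopologicalSpace M] [ChartedSpace E4 M]
  {α : MForm (𝓡 4) M ℝ 2} {z : M} {τ : E4} {c : ℝ} {A : E4 ≃L[ℝ] E4}
  {η : Fin 3 → E4 [⋀^Fin 2]→L[ℝ] ℝ} {S : Fin 3 → E4 → ℝ}

/-- **Perutz's form `S` in an adapted frame.**  If `A e₀ = τ`, `η_i(Au, Av) = c β_i(u, v)`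
(`i = 1, 2, 3`) and the gradient expands as `∇_{AW} α = Σ_k S_k(W) η_k`, then
`S_z(Av, Aw) = (∇_{Av} α)(τ, Aw) = c (S₀(v) w₁ + S₁(v) w₂ + S₂(v) w₃)`: restricted to the normal
directions `e₁, e₂, e₃` of the frame, the coefficient matrix of the gradient is the matrix of
Perutz's form `S_z` (Perutz 2006, §2 eq. (2): `∇ω = Σ S_ij e^i ⊗ β_j` in an adapted frame; §3).
[cite: Perutz2006, §2 eq. (2)] -/
theorem zeroNormalForm_frame (hA0 : A (stdVec 0) = τ)
    (h1 : ∀ u v, η 0 ![A u, A v] = c * hondaBeta₁ ![u, v])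
    (h2 : ∀ u v, η 1 ![A u, A v] = c * hondaBeta₂ ![u, v])
    (h3 : ∀ u v, η 2 ![A u, A v] = c * hondaBeta₃ ![u, v])
    (hexp : ∀ W, zeroGradient α z (A W) = ∑ k, S k W • η k) (v w : E4) :
    zeroNormalForm α z τ (A v) (A w) = c * (S 0 v * w 1 + S 1 v * w 2 + S 2 v * w 3) := by
  rw [zeroNormalForm_apply, ← hA0, hexp v]
  simp only [Fin.sum_univ_three, ContinuousAlternatingMap.add_apply,
    ContinuousAlternatingMap.smul_apply, smul_eq_mul, h1, h2, h3, hondaBeta₁_stdVec_zero,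
    hondaBeta₂_stdVec_zero, hondaBeta₃_stdVec_zero]
  ring

/-- The `3 × 3` matrix of the gradient in an adapted frame, normal block:
`M_{jk} = S_k(e_{j+1})`. [cite: Perutz2006, §2 eq. (2)] -/
def frameMatrix (S : Fin 3 → E4 → ℝ) : Matrix (Fin 3) (Fin 3) ℝ :=
  fun j k => S k (stdVec j.succ)

/-- Entries of `frameMatrix`. [folklore] -/
@[simp] theorem frameMatrix_apply (S : Fin 3 → E4 → ℝ) (j k : Fin 3) :
    frameMatrix S j k = S k (stdVec j.succ) := rfl

/-- In an adapted frame, `S_z(A e_{j+1}, A e_{k+1}) = c · M_{jk}`. [cite: Perutz2006, §2 eq. (2)] -/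
theorem zeroNormalForm_frame_stdVec (hA0 : A (stdVec 0) = τ)
    (h1 : ∀ u v, η 0 ![A u, A v] = c * hondaBeta₁ ![u, v])
    (h2 : ∀ u v, η 1 ![A u, A v] = c * hondaBeta₂ ![u, v])
    (h3 : ∀ u v, η 2 ![A u, A v] = c * hondaBeta₃ ![u, v])
    (hexp : ∀ W, zeroGradient α z (A W) = ∑ k, S k W • η k) (j k : Fin 3) :
    zeroNormalForm α z τ (A (stdVec j.succ)) (A (stdVec k.succ)) = c * frameMatrix S j k := by
  rw [zeroNormalForm_frame hA0 h1 h2 h3 hexp, frameMatrix_apply]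
  fin_cases k <;> simp [Fin.succ]

variable [IsManifold (𝓡 4) ∞ M]

/-- **Symmetry of the frame matrix for a closed form** (Perutz 2006, §2.3 (c): `dω = 0` forces
`S` to be symmetric): if moreover `c ≠ 0`, `α` is closed and `τ` is a kernel vector of the
gradient, then `M_{jk} = M_{kj}`. [cite: Perutz2006, §2.3] -/
theorem frameMatrix_symm (hcl : IsClosedForm α) (hτ : zeroGradient α z τ = 0) (hc : c ≠ 0)
    (hA0 : A (stdVec 0) = τ)
    (h1 : ∀ u v, η 0 ![A u, A v] = c * hondaBeta₁ ![u, v])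
    (h2 : ∀ u v, η 1 ![A u, A v] = c * hondaBeta₂ ![u, v])
    (h3 : ∀ u v, η 2 ![A u, A v] = c * hondaBeta₃ ![u, v])
    (hexp : ∀ W, zeroGradient α z (A W) = ∑ k, S k W • η k) :
    (frameMatrix S).IsSymm := by
  refine Matrix.IsSymm.ext fun j k => ?_
  have hs := IsClosedForm.zeroNormalForm_symm hcl hτ (A (stdVec k.succ)) (A (stdVec j.succ))
  rw [zeroNormalForm_frame_stdVec hA0 h1 h2 h3 hexp, zeroNormalForm_frame_stdVec hA0 h1 h2 h3 hexp]
    at hs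
  simpa [hc] using hs

/-- `dα` on the three normal frame vectors is `c · tr M` (the `e¹ ∧ e² ∧ e³`-component of
`d(x · M · β) = Σ M_jk e^j ∧ β_k` is the trace). [cite: Perutz2006, §2.3] -/
theorem mextDeriv_frame_normal
    (h1 : ∀ u v, η 0 ![A u, A v] = c * hondaBeta₁ ![u, v])
    (h2 : ∀ u v, η 1 ![A u, A v] = c * hondaBeta₂ ![u, v])
    (h3 : ∀ u v, η 2 ![A u, A v] = c * hondaBeta₃ ![u, v])
    (hexp : ∀ W, zeroGradient α z (A W) = ∑ k, S k W • η k) :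
    mextDeriv α z ![A (stdVec 1), A (stdVec 2), A (stdVec 3)] = c * (frameMatrix S).trace := by
  rw [mextDeriv_apply_three, Matrix.trace_fin_three]
  simp only [Matrix.cons_val_zero, Matrix.cons_val_one, Matrix.cons_val, hexp, Fin.sum_univ_three,
    ContinuousAlternatingMap.add_apply, ContinuousAlternatingMap.smul_apply, smul_eq_mul, h1, h2,
    h3, hondaBeta₁_apply, hondaBeta₂_apply, hondaBeta₃_apply, stdVec_apply, frameMatrix_apply]
  simp [Fin.succ]
  ring

/-- **The frame matrix of a closed form is trace-free** (Perutz 2006, §2.3 (c): `dω = 0` forces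
`S` to be trace-free for the conformal structure of `Λ⁺ = im ∇ω`; here: the normal component
of `dα = 0` in an adapted frame). [cite: Perutz2006, §2.3] -/
theorem frameMatrix_trace (hcl : IsClosedForm α) (hc : c ≠ 0)
    (h1 : ∀ u v, η 0 ![A u, A v] = c * hondaBeta₁ ![u, v])
    (h2 : ∀ u v, η 1 ![A u, A v] = c * hondaBeta₂ ![u, v])
    (h3 : ∀ u v, η 2 ![A u, A v] = c * hondaBeta₃ ![u, v])
    (hexp : ∀ W, zeroGradient α z (A W) = ∑ k, S k W • η k) :
    (frameMatrix S).trace = 0 := by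
  have h := mextDeriv_frame_normal h1 h2 h3 hexp
  rw [show mextDeriv α z = 0 from congrFun hcl z] at h
  have h0 : c * (frameMatrix S).trace = 0 := h.symm.trans rfl
  exact (mul_eq_zero.1 h0).resolve_left hc

end Frame

end Literature.Geometry.Symplectic

end
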